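import Mathlib.Data.Finset.BooleanAlgebra

/-!
# SCHEME Σ: face bookkeeping on two coordinate blocks (support file)

Support file (prover seat `prim-bnk-2`, gen 32; `--supports stmt-CriticalPhenomena-4575`).  Proof document:
`run/shared/lean/prim/prim-l12/prim-bnk-2/PROOF-THEOREM-I1.md` §0, §2; plan `SIGMA-ASSEMBLY-PLAN.md`.

The unit map `φ` of SCHEME Σ (THEOREM I₁: Conjecture V for one-shared-coordinate pairs, untwisted) acts on faces `(x, y)` of the
cube (third part `z = (x ∪ y)ᶜ`) by replacing the trace of ONE part on ONE coordinate block `K` (`K = I` or `K = J`) by a new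
trace `g ⊆ K`, possibly inserting the shared coordinate `e ∉ K`: `x' = (x \ K) ∪ g`, `x' = (x \ K) ∪ g ∪ {e}`, or
`y' = (y \ K) ∪ g`.  This file is the generic finset bookkeeping of these three shapes (traces on `K` and on a disjoint block
`K'`, membership of `e`, disjointness from the untouched part, domination, and the trace of the new third part), shared by the
admissibility and injectivity proofs of `φ`.  Pure `Finset` lemmas; no definitions; no `sorry`.
-/

namespace Summit.CriticalPhenomena.PercolationContinuityZ3.Theorems

namespace SahiFComb.Shift

open Finset

variable {ι : Type*} [DecidableEq ι]

/-- The `K`-trace of the third part of a face: `z ∩ K = (K \ (y ∩ K)) \ (x ∩ K)`. [folklore] -/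
theorem compl_union_inter_eq [Fintype ι] (x y K : Finset ι) : (x ∪ y)ᶜ ∩ K = (K \ (y ∩ K)) \ (x ∩ K) := by
  ext i
  simp only [mem_inter, mem_compl, mem_union, mem_sdiff, not_or, not_and]
  tauto

/-- The `K`-trace of the first part lies in the column cube `K \ (y ∩ K)`. [folklore] -/
theorem inter_subset_sdiff_inter {x y : Finset ι} (hxy : Disjoint x y) (K : Finset ι) : x ∩ K ⊆ K \ (y ∩ K) := by
  intro i hi
  rw [mem_inter] at hi
  rw [mem_sdiff, mem_inter]
  exact ⟨hi.2, fun h => disjoint_left.1 hxy hi.1 h.1⟩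

namespace OneShared

/-! ### New-face bookkeeping: `x' = (x \ K) ∪ g` -/

section NewFace

variable {K K' x y g : Finset ι}

/-- The `K`-trace of the new part is `g`. [folklore] -/
theorem nf_inter (hgK : g ⊆ K) : ((x \ K) ∪ g) ∩ K = g := by
  ext i; simp only [mem_inter, mem_union, mem_sdiff]
  constructor
  · rintro ⟨h | h, hi⟩
    · exact absurd hi h.2
    · exact h
  · intro hi; exact ⟨Or.inr hi, hgK hi⟩

/-- The trace on a disjoint block is unchanged. [folklore] -/
theorem nf_inter_other (hKK' : Disjoint K K') (hgK : g ⊆ K) : ((x \ K) ∪ g) ∩ K' = x ∩ K' := by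
  ext i; simp only [mem_inter, mem_union, mem_sdiff]
  constructor
  · rintro ⟨h | h, hi⟩
    · exact ⟨h.1, hi⟩
    · exact absurd hi (disjoint_left.1 hKK' (hgK h))
  · rintro ⟨hx, hi⟩; exact ⟨Or.inl ⟨hx, fun hK => disjoint_left.1 hKK' hK hi⟩, hi⟩

/-- Membership of a coordinate outside `K` is unchanged. [folklore] -/
theorem nf_mem_iff {e : ι} (heK : e ∉ K) (hgK : g ⊆ K) : e ∈ (x \ K) ∪ g ↔ e ∈ x := by
  rw [mem_union, mem_sdiff]
  constructor
  · rintro (⟨h, -⟩ | h)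
    · exact h
    · exact absurd (hgK h) heK
  · intro h; exact Or.inl ⟨h, heK⟩

/-- The new part is still disjoint from `y`. [folklore] -/
theorem nf_disjoint (hxy : Disjoint x y) (hgR : g ⊆ K \ (y ∩ K)) : Disjoint ((x \ K) ∪ g) y := by
  rw [disjoint_union_left]
  refine ⟨disjoint_of_subset_left sdiff_subset hxy, disjoint_left.2 fun i hi hiy => ?_⟩
  have := hgR hi
  rw [mem_sdiff, mem_inter] at this
  exact this.2 ⟨hiy, this.1⟩

/-- Domination. [folklore] -/
theorem nf_subset (hxg : x ∩ K ⊆ g) : x ⊆ (x \ K) ∪ g := by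
  intro i hi
  by_cases hiK : i ∈ K
  · exact mem_union_right _ (hxg (mem_inter.2 ⟨hi, hiK⟩))
  · exact mem_union_left _ (mem_sdiff.2 ⟨hi, hiK⟩)

/-- The `K`-trace of the new third part. [folklore] -/
theorem nf_compl_inter [Fintype ι] (hgK : g ⊆ K) : (((x \ K) ∪ g) ∪ y)ᶜ ∩ K = (K \ (y ∩ K)) \ g := by
  rw [compl_union_inter_eq, nf_inter hgK]

/-- Two new parts with the same `K`-block data agree on `K` iff the new traces agree. [folklore] -/
theorem nf_eq_nf_inter {x' g' : Finset ι} (hgK : g ⊆ K) (hg'K : g' ⊆ K) (h : (x \ K) ∪ g = (x' \ K) ∪ g') : g = g' := by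
  have h1 : ((x \ K) ∪ g) ∩ K = ((x' \ K) ∪ g') ∩ K := by rw [h]
  rwa [nf_inter hgK, nf_inter hg'K] at h1

/-- Two new parts agree on a disjoint block iff the old parts do. [folklore] -/
theorem nf_eq_nf_inter_other {x' g' : Finset ι} (hKK' : Disjoint K K') (hgK : g ⊆ K) (hg'K : g' ⊆ K)
    (h : (x \ K) ∪ g = (x' \ K) ∪ g') : x ∩ K' = x' ∩ K' := by
  have h1 : ((x \ K) ∪ g) ∩ K' = ((x' \ K) ∪ g') ∩ K' := by rw [h]
  rwa [nf_inter_other hKK' hgK, nf_inter_other hKK' hg'K] at h1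

end NewFace

/-! ### New-face bookkeeping with `e` inserted: `x' = (x \ K) ∪ g ∪ {e}` -/

section NewFaceE

variable {K K' x y g : Finset ι} {e : ι}

/-- `K`-trace. [folklore] -/
theorem nfe_inter (heK : e ∉ K) (hgK : g ⊆ K) : ((x \ K) ∪ g ∪ {e}) ∩ K = g := by
  rw [union_inter_distrib_right, nf_inter hgK, singleton_inter_of_notMem heK, union_empty]

/-- Trace on the other block. [folklore] -/
theorem nfe_inter_other (hKK' : Disjoint K K') (heK' : e ∉ K') (hgK : g ⊆ K) :
    ((x \ K) ∪ g ∪ {e}) ∩ K' = x ∩ K' := by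
  rw [union_inter_distrib_right, nf_inter_other hKK' hgK, singleton_inter_of_notMem heK', union_empty]

/-- `e` belongs to the new part. [folklore] -/
theorem nfe_mem : e ∈ (x \ K) ∪ g ∪ {e} := mem_union_right _ (mem_singleton_self e)

/-- Disjointness from `y`. [folklore] -/
theorem nfe_disjoint (hxy : Disjoint x y) (hgR : g ⊆ K \ (y ∩ K)) (hey : e ∉ y) :
    Disjoint ((x \ K) ∪ g ∪ {e}) y := by
  rw [disjoint_union_left]
  exact ⟨nf_disjoint hxy hgR, disjoint_singleton_left.2 hey⟩

/-- Domination. [folklore] -/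
theorem nfe_subset (hxg : x ∩ K ⊆ g) : x ⊆ (x \ K) ∪ g ∪ {e} :=
  (nf_subset hxg).trans subset_union_left

/-- `K`-trace of the new third part. [folklore] -/
theorem nfe_compl_inter [Fintype ι] (heK : e ∉ K) (hgK : g ⊆ K) :
    (((x \ K) ∪ g ∪ {e}) ∪ y)ᶜ ∩ K = (K \ (y ∩ K)) \ g := by
  rw [compl_union_inter_eq, nfe_inter heK hgK]

/-- `e` is not in the new third part. [folklore] -/
theorem nfe_notMem_compl [Fintype ι] : e ∉ (((x \ K) ∪ g ∪ {e}) ∪ y)ᶜ := by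
  rw [mem_compl, not_not, mem_union]; exact Or.inl nfe_mem

/-- Two new parts (with `e`) agree on `K` iff the new traces agree. [folklore] -/
theorem nfe_eq_nfe_inter {x' g' : Finset ι} (heK : e ∉ K) (hgK : g ⊆ K) (hg'K : g' ⊆ K)
    (h : (x \ K) ∪ g ∪ {e} = (x' \ K) ∪ g' ∪ {e}) : g = g' := by
  have h1 : ((x \ K) ∪ g ∪ {e}) ∩ K = ((x' \ K) ∪ g' ∪ {e}) ∩ K := by rw [h]
  rwa [nfe_inter heK hgK, nfe_inter heK hg'K] at h1

/-- Two new parts (with `e`) agree on a disjoint block avoiding `e` iff the old parts do. [folklore] -/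
theorem nfe_eq_nfe_inter_other {x' g' : Finset ι} (hKK' : Disjoint K K') (heK' : e ∉ K') (hgK : g ⊆ K) (hg'K : g' ⊆ K)
    (h : (x \ K) ∪ g ∪ {e} = (x' \ K) ∪ g' ∪ {e}) : x ∩ K' = x' ∩ K' := by
  have h1 : ((x \ K) ∪ g ∪ {e}) ∩ K' = ((x' \ K) ∪ g' ∪ {e}) ∩ K' := by rw [h]
  rwa [nfe_inter_other hKK' heK' hgK, nfe_inter_other hKK' heK' hg'K] at h1

end NewFaceE

/-! ### Row bookkeeping: `y' = (y \ K) ∪ g`, `x` fixed -/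

section RowFace

variable {K x y g : Finset ι}

/-- `K`-trace of the third part when the SECOND part is modified. [folklore] -/
theorem nfy_compl_inter [Fintype ι] (hgK : g ⊆ K) : (x ∪ ((y \ K) ∪ g))ᶜ ∩ K = (K \ (x ∩ K)) \ g := by
  rw [union_comm, compl_union_inter_eq, nf_inter hgK]

/-- `K`-trace of the third part of the original face, row form. [folklore] -/
theorem compl_union_inter_eq' [Fintype ι] (x y K : Finset ι) : (x ∪ y)ᶜ ∩ K = (K \ (x ∩ K)) \ (y ∩ K) := by
  rw [union_comm, compl_union_inter_eq]

end RowFace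

/-! ### Mixed parts: `(s ∩ K') ∪ g` with `g` outside `K'` -/

section Mixed

variable {K' s g : Finset ι}

/-- The `K'`-trace of `(s ∩ K') ∪ g` is `s ∩ K'` when `g` avoids `K'`. [folklore] -/
theorem inter_union_inter_eq (hg : ∀ i ∈ g, i ∉ K') : ((s ∩ K') ∪ g) ∩ K' = s ∩ K' := by
  ext i
  simp only [mem_inter, mem_union]
  constructor
  · rintro ⟨h | h, hi⟩
    · exact h
    · exact absurd hi (hg i h)
  · intro h; exact ⟨Or.inl h, h.2⟩

/-- `(s ∩ K') ∪ g` minus `K'` is `g` when `g` avoids `K'`. [folklore] -/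
theorem inter_union_sdiff_eq (hg : ∀ i ∈ g, i ∉ K') : ((s ∩ K') ∪ g) \ K' = g := by
  ext i
  simp only [mem_sdiff, mem_union, mem_inter]
  constructor
  · rintro ⟨h | h, hi⟩
    · exact absurd h.2 hi
    · exact h
  · intro h; exact ⟨Or.inr h, hg i h⟩

/-- The trace of `(s ∩ K') ∪ g` on a block `K` containing `g` and disjoint from `K'` is `g`. [folklore] -/
theorem inter_union_inter_eq_right {K : Finset ι} (hKK' : Disjoint K' K) (hgK : g ⊆ K) : ((s ∩ K') ∪ g) ∩ K = g := by
  ext i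
  simp only [mem_inter, mem_union]
  constructor
  · rintro ⟨h | h, hi⟩
    · exact absurd hi (disjoint_left.1 hKK' h.2)
    · exact h
  · intro h; exact ⟨Or.inr h, hgK h⟩

end Mixed

end OneShared

end SahiFComb.Shift

end Summit.CriticalPhenomena.PercolationContinuityZ3.Theorems
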